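import Summits.ValiantsHypothesis.ValiantsHypothesis.Theorems.PolySwallowForcesShortRelation.Negative.TermHop

/-!
# Depth-one hopping over `B₃` pools is capped by the number of sources (refuter file, supports stmt-ValiantsHypothesis-6537)

Context: crux `GirthSidon.PolySwallowForcesShortRelation`, line `two_ended_honesty`, stub `stub_totallyBornTargets`;
free-exponent model of `Cruxes/PolySwallowForcesShortRelation/TERMHOP-d1.md`.  Write `W = span x^T ⊕ N` (`T` = pool of
monomial exponents, `N` with reduced basis `g_1 … g_r`).  A DEPTH-ONE target is a monomial `x^d ∈ x^T·N + span x^{T+T}`,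
i.e. `x^d ≡ Σᵢ hᵢ gᵢ (mod span x^{T+T})` with multipliers `hᵢ ∈ span x^T`.  `Negative/TermHop.lean` shows that over a
`B₃` pool a single source hops at most once (`depth_one_target_unique_of_B3`).  Here: the MULTI-SOURCE version.

* `depth_one_targets_le_sources_of_B3`: over a `B₃` pool, `r` sources whose degrees are pairwise non-aligned with the
  pool (`deg gᵢ − deg gⱼ ∉ T − T` for `i ≠ j`) admit at most `r` distinct depth-one targets off `T + T` and off the
  top-born exponents `deg gᵢ + T` (in particular at most `r` totally-born depth-one targets), so depth one alone gives
  `m ≤ r < n = |T| + r` there — no counterexample to the stub.  Residual classes NOT covered: pools that are not `B₃`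
  (the census of `TERMHOP-d1.md`), aligned source degrees (multi-source telescoping), depth two (`N·N`).
* `depth_one_targets_le_of_B3_aligned`: the aligned case is charged, not forbidden — at most `r + |P|` such targets for any
  `P ⊇` the alignment events `(i, t)` (`deg gᵢ + t = deg gⱼ + t'`, `j ≠ i`, `t, t' ∈ T`); structured aligned designs
  (`TERMHOP-d1.md` §2b) do reach `≈ 2r`, and the closed-form aligned family there has `m ≤ r log₃ r`.

VP ≠ VNP is not moved by anything here.
-/

set_option linter.dupNamespace false

open Polynomial
open scoped Pointwise

namespace Summit.ValiantsHypothesis.ValiantsHypothesis.Theorems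

namespace PolySwallowForcesShortRelation.Negative.DepthOneB3

open PolySwallowForcesShortRelation.Negative.TermHop

variable {K : Type*} [Field K]

/-- **All of depth one over a `B₃` pool: at most `r` totally-born targets from `r` sources.**
Pool `T` (`B₃`), sources `g_1 … g_r ≠ 0` with top exponents `deg gᵢ ∉ T`, pairwise NON-ALIGNED with the pool
(`deg gᵢ + t = deg gⱼ + t'` with `t, t' ∈ T` only for `i = j`).  Suppose `L` depth-one combinations
`Σᵢ h_{l,i} gᵢ ≡ c_l X^{d_l} (mod span x^{T+T})` with multipliers `h_{l,i} ∈ span x^T`, `c_l ≠ 0`, pairwise distinct targets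
`d_l ∉ T + T` avoiding the top-born exponents `deg gᵢ + T`.  Then `L ≤ r`.
Proof: let `βᵢ` be the (by `absorb_unique_of_B3` unique) shift absorbing `deg gᵢ`.  The vectors `(h_{l,i}.coeff βᵢ)ᵢ ∈ K^r`
are linearly independent: a vanishing combination `λ` gives combined multipliers `Hᵢ = Σ_l λ_l h_{l,i}` with
`Hᵢ.coeff βᵢ = 0`; if some `Hᵢ ≠ 0`, the top exponent `deg H_{i₀} + deg g_{i₀}` of `Σ Hᵢ gᵢ` is attained once
(non-alignment), has non-zero coefficient, is not a target (top-born) hence absorbed, so `deg H_{i₀} = β_{i₀}` —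
contradicting `H_{i₀}.coeff β_{i₀} = 0`; so all `Hᵢ = 0`, and reading off the coefficients at the `d_l` gives `λ = 0`.
Consequence for the stub: over `B₃` pools with non-aligned sources the whole DEPTH-ONE mechanism (multi-source, multi-shift)
yields at most `r < n` totally-born targets; what remains there is aligned source degrees (`deg gᵢ − deg gⱼ ∈ T − T`,
multi-source telescoping) and depth two (`N·N`). [folklore] -/
theorem depth_one_targets_le_sources_of_B3 {T : Finset ℕ}
    (hB3 : ∀ a ∈ T, ∀ b ∈ T, ∀ c ∈ T, ∀ a' ∈ T, ∀ b' ∈ T, ∀ c' ∈ T,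
      a + b + c = a' + b' + c' → ({a, b, c} : Multiset ℕ) = {a', b', c'})
    {r : ℕ} {g : Fin r → K[X]} (hg0 : ∀ i, g i ≠ 0) (hgT : ∀ i, (g i).natDegree ∉ T)
    (halign : ∀ i j, ∀ t ∈ T, ∀ t' ∈ T, (g i).natDegree + t = (g j).natDegree + t' → i = j)
    {L : ℕ} {h : Fin L → Fin r → K[X]} (hhT : ∀ l i, ∀ t ∈ (h l i).support, t ∈ T)
    {d : Fin L → ℕ} {c : Fin L → K} (hc : ∀ l, c l ≠ 0) (hd : Function.Injective d)
    (hdTT : ∀ l, d l ∉ T + T) (hdtop : ∀ l i, ∀ t ∈ T, d l ≠ (g i).natDegree + t)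
    (hsucc : ∀ l, ∀ n ∈ (∑ i, h l i * g i - C (c l) * X ^ (d l)).support, n ∈ T + T) :
    L ≤ r := by
  classical
  -- the unique absorbing shift of the top exponent of each source
  have hβex : ∀ i, ∃ β : ℕ, ∀ t ∈ T, (g i).natDegree + t ∈ T + T → t = β := by
    intro i
    by_cases hx : ∃ t ∈ T, (g i).natDegree + t ∈ T + T
    · obtain ⟨β, hβT, hβabs⟩ := hx
      exact ⟨β, fun t ht habs => absorb_unique_of_B3 hB3 (hgT i) ht hβT habs hβabs⟩
    · exact ⟨0, fun t ht habs => (hx ⟨t, ht, habs⟩).elim⟩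
  choose β hβ using hβex
  -- coefficient bookkeeping for the successful combinations
  set P : Fin L → K[X] := fun l => ∑ i, h l i * g i with hP
  have hcoeffP : ∀ l n, n ∉ T + T → (P l).coeff n = if n = d l then c l else 0 := by
    intro l n hn
    have h0 : (P l - C (c l) * X ^ (d l)).coeff n = 0 := by
      by_contra hne
      exact hn (hsucc l n (Polynomial.mem_support_iff.mpr hne))
    rw [Polynomial.coeff_sub, Polynomial.coeff_C_mul_X_pow, sub_eq_zero] at h0
    exact h0
  -- the vectors of β-coefficients are linearly independent
  let v : Fin L → (Fin r → K) := fun l i => (h l i).coeff (β i)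
  suffices hli : LinearIndependent K v by
    have := hli.fintype_card_le_finrank
    simpa using this
  rw [Fintype.linearIndependent_iff]
  intro lam hlam
  -- combined multipliers
  set H : Fin r → K[X] := fun i => ∑ l, lam l • h l i with hH
  have hHT : ∀ i, ∀ t ∈ (H i).support, t ∈ T := by
    intro i t ht
    rw [Polynomial.mem_support_iff, hH] at ht
    simp only [Polynomial.finsetSum_coeff, Polynomial.coeff_smul, smul_eq_mul] at ht
    obtain ⟨l, -, hl⟩ := Finset.exists_ne_zero_of_sum_ne_zero ht
    exact hhT l i t (Polynomial.mem_support_iff.mpr (right_ne_zero_of_mul hl))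
  have hHβ : ∀ i, (H i).coeff (β i) = 0 := by
    intro i
    have := congrFun hlam i
    simpa [v, hH, Polynomial.finsetSum_coeff, Polynomial.coeff_smul, Finset.sum_apply] using this
  have hF : ∑ i, H i * g i = ∑ l, lam l • P l := by
    simp only [hH, hP, Finset.sum_mul, smul_mul_assoc, Finset.smul_sum]
    rw [Finset.sum_comm]
  -- Claim A: all combined multipliers vanish
  have hH0 : ∀ i, H i = 0 := by
    by_contra hcon
    push Not at hcon
    set S := Finset.univ.filter (fun i => H i ≠ 0) with hS
    have hSne : S.Nonempty := by
      obtain ⟨i, hi⟩ := hcon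
      exact ⟨i, by simp [hS, hi]⟩
    obtain ⟨i₀, hi₀S, hi₀max⟩ :=
      Finset.exists_mem_eq_sup' hSne (fun i => (H i).natDegree + (g i).natDegree)
    have hHi₀ : H i₀ ≠ 0 := by simpa [hS] using hi₀S
    have hdegT : (H i₀).natDegree ∈ T := hHT i₀ _ (Polynomial.natDegree_mem_support_of_nonzero hHi₀)
    -- every other non-zero source term has smaller top exponent (non-alignment)
    have hlt : ∀ i ∈ S, i ≠ i₀ →
        (H i).natDegree + (g i).natDegree < (H i₀).natDegree + (g i₀).natDegree := by
      intro i hi hne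
      have hle : (H i).natDegree + (g i).natDegree ≤ (H i₀).natDegree + (g i₀).natDegree := by
        have := Finset.le_sup' (fun i => (H i).natDegree + (g i).natDegree) hi
        rw [hi₀max] at this
        exact this
      rcases lt_or_eq_of_le hle with hlt | heq
      · exact hlt
      · exfalso
        have hHi : H i ≠ 0 := by simpa [hS] using hi
        have hdegTi : (H i).natDegree ∈ T := hHT i _ (Polynomial.natDegree_mem_support_of_nonzero hHi)
        have : (g i).natDegree + (H i).natDegree = (g i₀).natDegree + (H i₀).natDegree := by omega
        exact hne (halign i i₀ _ hdegTi _ hdegT this)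
    -- the coefficient of Σ H i * g i at the top exponent M is the leading term of H i₀ * g i₀
    have hcoefM_ne : (∑ i, H i * g i).coeff ((H i₀).natDegree + (g i₀).natDegree) ≠ 0 := by
      rw [Polynomial.finsetSum_coeff, Finset.sum_eq_single i₀]
      · rw [← Polynomial.natDegree_mul hHi₀ (hg0 i₀)]
        exact Polynomial.leadingCoeff_ne_zero.mpr (mul_ne_zero hHi₀ (hg0 i₀))
      · intro i _ hne
        by_cases hHi : H i = 0
        · simp [hHi]
        · have hiS : i ∈ S := by simp [hS, hHi]
          apply Polynomial.coeff_eq_zero_of_natDegree_lt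
          rw [Polynomial.natDegree_mul hHi (hg0 i)]
          exact hlt i hiS hne
      · intro h; exact (h (Finset.mem_univ _)).elim
    -- M is not a target (top-born), hence it is absorbed
    have hMd : ∀ l, (H i₀).natDegree + (g i₀).natDegree ≠ d l := by
      intro l hEq
      exact hdtop l i₀ _ hdegT (by rw [← hEq]; ring)
    have hMTT : (H i₀).natDegree + (g i₀).natDegree ∈ T + T := by
      by_contra hMTT
      apply hcoefM_ne
      rw [hF, Polynomial.finsetSum_coeff]
      refine Finset.sum_eq_zero fun l _ => ?_
      rw [Polynomial.coeff_smul, hcoeffP l _ hMTT, if_neg (hMd l), smul_zero]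
    -- so the degree of H i₀ is the absorbing shift β i₀, whose coefficient vanishes: contradiction
    have hdegβ : (H i₀).natDegree = β i₀ := hβ i₀ _ hdegT (add_comm (H i₀).natDegree _ ▸ hMTT)
    have : (H i₀).coeff (β i₀) ≠ 0 := by
      rw [← hdegβ]
      exact Polynomial.leadingCoeff_ne_zero.mpr hHi₀
    exact this (hHβ i₀)
  -- Claim B: the combination is trivial
  intro l₀
  have hF0 : (∑ l, lam l • P l).coeff (d l₀) = 0 := by
    rw [← hF]
    simp [hH0]
  rw [Polynomial.finsetSum_coeff, Finset.sum_eq_single l₀] at hF0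
  · rw [Polynomial.coeff_smul, hcoeffP l₀ (d l₀) (hdTT l₀), if_pos rfl, smul_eq_mul] at hF0
    exact (mul_eq_zero.mp hF0).resolve_right (hc l₀)
  · intro l _ hne
    rw [Polynomial.coeff_smul, hcoeffP l (d l₀) (hdTT l₀), if_neg (fun hEq => hne (hd hEq).symm), smul_zero]
  · intro hh; exact (hh (Finset.mem_univ _)).elim

set_option maxHeartbeats 400000 in
/-- **Quantitative aligned version: at most `r + #P` depth-one targets, `P` ⊇ the alignment events.**
As `depth_one_targets_le_sources_of_B3`, but instead of forbidding aligned source degrees we CHARGE for them: let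
`P ⊇ {(i, t) : t ∈ T, ∃ j ≠ i, ∃ t' ∈ T, deg gᵢ + t = deg gⱼ + t'}` (the shifts at which the top of source `i` can be cancelled
by the top of another source; over a Sidon pool each unordered pair `{i, j}` contributes at most one event to each of `i`, `j`).
Then the number `L` of distinct depth-one targets off `T + T` and off `deg gᵢ + T` is at most `r + |P|`.
Proof: the coordinates `(h_{l,i}.coeff βᵢ)ᵢ` together with `(h_{l,i}.coeff t)_{(i,t) ∈ P}` are linearly independent — in a
vanishing combination the top exponent of `Σ Hᵢ gᵢ` is attained once (a tie is an alignment event at a shift whose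
coefficient vanishes), and the rest is as before.  With `P = ∅` this is the non-aligned theorem. [folklore] -/
theorem depth_one_targets_le_of_B3_aligned {T : Finset ℕ}
    (hB3 : ∀ a ∈ T, ∀ b ∈ T, ∀ c ∈ T, ∀ a' ∈ T, ∀ b' ∈ T, ∀ c' ∈ T,
      a + b + c = a' + b' + c' → ({a, b, c} : Multiset ℕ) = {a', b', c'})
    {r : ℕ} {g : Fin r → K[X]} (hg0 : ∀ i, g i ≠ 0) (hgT : ∀ i, (g i).natDegree ∉ T)
    (P : Finset (Fin r × ℕ))
    (hP : ∀ i j, i ≠ j → ∀ t ∈ T, ∀ t' ∈ T, (g i).natDegree + t = (g j).natDegree + t' → (i, t) ∈ P)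
    {L : ℕ} {h : Fin L → Fin r → K[X]} (hhT : ∀ l i, ∀ t ∈ (h l i).support, t ∈ T)
    {d : Fin L → ℕ} {c : Fin L → K} (hc : ∀ l, c l ≠ 0) (hd : Function.Injective d)
    (hdTT : ∀ l, d l ∉ T + T) (hdtop : ∀ l i, ∀ t ∈ T, d l ≠ (g i).natDegree + t)
    (hsucc : ∀ l, ∀ n ∈ (∑ i, h l i * g i - C (c l) * X ^ (d l)).support, n ∈ T + T) :
    L ≤ r + P.card := by
  classical
  have hβex : ∀ i, ∃ β : ℕ, ∀ t ∈ T, (g i).natDegree + t ∈ T + T → t = β := by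
    intro i
    by_cases hx : ∃ t ∈ T, (g i).natDegree + t ∈ T + T
    · obtain ⟨β, hβT, hβabs⟩ := hx
      exact ⟨β, fun t ht habs => absorb_unique_of_B3 hB3 (hgT i) ht hβT habs hβabs⟩
    · exact ⟨0, fun t ht habs => (hx ⟨t, ht, habs⟩).elim⟩
  choose β hβ using hβex
  set Pl : Fin L → K[X] := fun l => ∑ i, h l i * g i with hPl
  have hcoeffP : ∀ l n, n ∉ T + T → (Pl l).coeff n = if n = d l then c l else 0 := by
    intro l n hn
    have h0 : (Pl l - C (c l) * X ^ (d l)).coeff n = 0 := by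
      by_contra hne
      exact hn (hsucc l n (Polynomial.mem_support_iff.mpr hne))
    rw [Polynomial.coeff_sub, Polynomial.coeff_C_mul_X_pow, sub_eq_zero] at h0
    exact h0
  -- coordinates: the β-coefficients and the coefficients at alignable shifts
  let v : Fin L → (Fin r ⊕ ↥P → K) := fun l x =>
    match x with
    | Sum.inl i => (h l i).coeff (β i)
    | Sum.inr p => (h l p.1.1).coeff p.1.2
  suffices hli : LinearIndependent K v by
    have := hli.fintype_card_le_finrank
    simpa [Module.finrank_fintype_fun_eq_card, Fintype.card_sum] using this
  rw [Fintype.linearIndependent_iff]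
  intro lam hlam
  set H : Fin r → K[X] := fun i => ∑ l, lam l • h l i with hH
  have hHT : ∀ i, ∀ t ∈ (H i).support, t ∈ T := by
    intro i t ht
    rw [Polynomial.mem_support_iff, hH] at ht
    simp only [Polynomial.finsetSum_coeff, Polynomial.coeff_smul, smul_eq_mul] at ht
    obtain ⟨l, -, hl⟩ := Finset.exists_ne_zero_of_sum_ne_zero ht
    exact hhT l i t (Polynomial.mem_support_iff.mpr (right_ne_zero_of_mul hl))
  have hHβ : ∀ i, (H i).coeff (β i) = 0 := by
    intro i
    have := congrFun hlam (Sum.inl i)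
    simpa [v, hH, Polynomial.finsetSum_coeff, Polynomial.coeff_smul, Finset.sum_apply] using this
  have hHP : ∀ p ∈ P, (H p.1).coeff p.2 = 0 := by
    intro p hp
    have := congrFun hlam (Sum.inr ⟨p, hp⟩)
    simpa [v, hH, Polynomial.finsetSum_coeff, Polynomial.coeff_smul, Finset.sum_apply] using this
  have hF : ∑ i, H i * g i = ∑ l, lam l • Pl l := by
    simp only [hH, hPl, Finset.sum_mul, smul_mul_assoc, Finset.smul_sum]
    rw [Finset.sum_comm]
  have hH0 : ∀ i, H i = 0 := by
    by_contra hcon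
    push Not at hcon
    set S := Finset.univ.filter (fun i => H i ≠ 0) with hS
    have hSne : S.Nonempty := by
      obtain ⟨i, hi⟩ := hcon
      exact ⟨i, by simp [hS, hi]⟩
    obtain ⟨i₀, hi₀S, hi₀max⟩ :=
      Finset.exists_mem_eq_sup' hSne (fun i => (H i).natDegree + (g i).natDegree)
    have hHi₀ : H i₀ ≠ 0 := by simpa [hS] using hi₀S
    have hdegT : (H i₀).natDegree ∈ T := hHT i₀ _ (Polynomial.natDegree_mem_support_of_nonzero hHi₀)
    have hlc : (H i₀).coeff (H i₀).natDegree ≠ 0 := Polynomial.leadingCoeff_ne_zero.mpr hHi₀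
    -- every other non-zero source term has smaller top exponent: an equal top would be an alignment event at a
    -- shift whose coefficient vanishes
    have hlt : ∀ i ∈ S, i ≠ i₀ →
        (H i).natDegree + (g i).natDegree < (H i₀).natDegree + (g i₀).natDegree := by
      intro i hi hne
      have hle : (H i).natDegree + (g i).natDegree ≤ (H i₀).natDegree + (g i₀).natDegree := by
        have := Finset.le_sup' (fun i => (H i).natDegree + (g i).natDegree) hi
        rw [hi₀max] at this
        exact this
      rcases lt_or_eq_of_le hle with hlt | heq
      · exact hlt
      · exfalso
        have hHi : H i ≠ 0 := by simpa [hS] using hi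
        have hdegTi : (H i).natDegree ∈ T := hHT i _ (Polynomial.natDegree_mem_support_of_nonzero hHi)
        have : (g i₀).natDegree + (H i₀).natDegree = (g i).natDegree + (H i).natDegree := by omega
        exact hlc (hHP _ (hP i₀ i (Ne.symm hne) _ hdegT _ hdegTi this))
    have hcoefM_ne : (∑ i, H i * g i).coeff ((H i₀).natDegree + (g i₀).natDegree) ≠ 0 := by
      rw [Polynomial.finsetSum_coeff, Finset.sum_eq_single i₀]
      · rw [← Polynomial.natDegree_mul hHi₀ (hg0 i₀)]
        exact Polynomial.leadingCoeff_ne_zero.mpr (mul_ne_zero hHi₀ (hg0 i₀))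
      · intro i _ hne
        by_cases hHi : H i = 0
        · simp [hHi]
        · have hiS : i ∈ S := by simp [hS, hHi]
          apply Polynomial.coeff_eq_zero_of_natDegree_lt
          rw [Polynomial.natDegree_mul hHi (hg0 i)]
          exact hlt i hiS hne
      · intro h; exact (h (Finset.mem_univ _)).elim
    have hMd : ∀ l, (H i₀).natDegree + (g i₀).natDegree ≠ d l := by
      intro l hEq
      exact hdtop l i₀ _ hdegT (by rw [← hEq]; ring)
    have hMTT : (H i₀).natDegree + (g i₀).natDegree ∈ T + T := by
      by_contra hMTT
      apply hcoefM_ne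
      rw [hF, Polynomial.finsetSum_coeff]
      refine Finset.sum_eq_zero fun l _ => ?_
      rw [Polynomial.coeff_smul, hcoeffP l _ hMTT, if_neg (hMd l), smul_zero]
    have hdegβ : (H i₀).natDegree = β i₀ := hβ i₀ _ hdegT (add_comm (H i₀).natDegree _ ▸ hMTT)
    rw [hdegβ] at hlc
    exact hlc (hHβ i₀)
  intro l₀
  have hF0 : (∑ l, lam l • Pl l).coeff (d l₀) = 0 := by
    rw [← hF]
    simp [hH0]
  rw [Polynomial.finsetSum_coeff, Finset.sum_eq_single l₀] at hF0
  · rw [Polynomial.coeff_smul, hcoeffP l₀ (d l₀) (hdTT l₀), if_pos rfl, smul_eq_mul] at hF0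
    exact (mul_eq_zero.mp hF0).resolve_right (hc l₀)
  · intro l _ hne
    rw [Polynomial.coeff_smul, hcoeffP l (d l₀) (hdTT l₀), if_neg (fun hEq => hne (hd hEq).symm), smul_zero]
  · intro hh; exact (hh (Finset.mem_univ _)).elim


end PolySwallowForcesShortRelation.Negative.DepthOneB3

end Summit.ValiantsHypothesis.ValiantsHypothesis.Theorems
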